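import Literature.MathematicalPhysics.QuantumFieldTheory.Balaban1983to89.B9Thm31GpAgmonDecayZd
import Literature.MathematicalPhysics.QuantumFieldTheory.Balaban1983to89.B9Thm31GreenPrimeGradientL2BoundZd

/-!
# `Balaban1983to89.B9Eq346AgmonGradientZd` — [Balaban1985BackgroundPropagators] Thm 3.1 (3.46) p. 398, THE GRADIENT ENTRY («‖hζ∇_U G′(U)λ‖(Lʲη) ≦ B₀(Lʲη)(Lʲ′η)
# e^{−δ₀d(y,y′)}‖h‖‖λ‖») FOR THE GENUINE `G′(U₀)` AT THE `ℤᵈ` CARRIER, BY AGMON'S METHOD: the conjugated form dominates `(1−θ)·` the GRADIENT ENERGY, so the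
# Agmon reading bounds the weighted gradient energy of the solution — ★★★ `Σ_μ Σ_x |D^η_{U₀,μ}(ω·G′(U₀)Ψ)(x)|²_τ ≤ ‖Ψ‖²_τ ∕ ((1−θ)²·c₀·M_B)` (`ω = 1` on `B ⊇ supp Ψ`,
# `M ≥ M_B` on `B`) — ONE inverse mass, print's `(Lʲ′η)²`; and unweighted on a tail set `A` (`ω ≥ W` on `A ∪ (A + e_μ)`, `M ≥ M_A` there):
# `Σ_{x∈A}|D_μ(G′(U₀)Ψ)(x)|²_τ ≤ (2∕W²)·‖Ψ‖²_τ∕((1−θ)²c₀M_B) + 2η⁻²r²·‖Ψ‖²_τ∕(((1−θ)c₀)²M_AM_BW²)` for bond ratios `|ω(x+e_μ)∕ω(x) − 1| ≤ r`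

statement-level skeleton of published theorems with citation tags; proofs where landed; nothing here is a claim about the
Yang–Mills mass gap

`[Balaban1985BackgroundPropagators]` ("B9", CMP **99** (1985) 389–434) p. 398 (3.46): *«‖hG′(U)λ‖, ‖hζ∇_U G′(U)λ‖(Lʲη), ‖hζΔ_U G′(U)λ‖(Lʲη)², … ≦ B₀(Lʲη)(Lʲ′η)e^{−δ₀d(y,y′)}
‖h‖‖λ‖»* — the gradient entry carries ONE factor `(Lʲη)` less than the value entry.  Print: random walk (Sect. B).  In the Agmon road of this seat (FILES 1–8) the
conjugated form `⟨ωΦ, Δ′_a(ω⁻¹Φ)⟩_τ` was read against the level masses only; but it ALSO dominates `(1−θ)⟨Φ, Δ′_aΦ⟩_τ ≥ (1−θ)·Σ_μΣ_x|D_μΦ|²_τ` (the penalty is non-negative,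
dag-n06-w4 g4's `gradEnergy_le_formE_deltaPrimeADom`), so the same reading at `Φ′ = ω·G′Ψ` bounds the WEIGHTED GRADIENT ENERGY by `‖1_BΦ‖‖Ψ‖ ≤ ‖Ψ‖²∕((1−θ)c₀M_B)` — one
inverse mass, which at level masses `(Lʲ′η)⁻²` is print's `(Lʲ′η)²`, i.e. (3.46)'s gradient entry after dividing by `(Lʲη)²` on the observation side.  Unweighting on a set
`A` in the tail costs `W⁻²` and the bond ratio of `ω` (`covDerivFwd_scale`).

CITATION HEADER (lean-in-tree rule).  Cell `pub-ymgap` (YM Track A, HUMAN RULING D-0062 ∕ D-0149 width push), DAG node N06 = [B9], width seat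
`pub-ymgap-dag-n06-w2` (g5), CLAIM-9.  Inputs BY NAME: FILE 1's `formE_scaleFn_left ∕ formE_scaleFn_indicator_self ∕ scaleFn_scaleFn ∕ scaleFn_inv_scaleFn ∕ sq_sum_le_of_coercive ∕
sq_sum_le_of_conj_coercive ∕ conj_coercive_of_defect`, FILE 2a's `covDerivFwd_scale ∕ finsum_pair_covDerivFwd_eq_sum`, FILE 3's `formE_conj_deltaPrimeADom_ge_of_masses`, dag-n06-w4
g4's `gradEnergy_le_formE_deltaPrimeADom`, g2's `GpZd ∕ deltaPrimeADom_GpZd`, the engine.  Nothing restated.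

WHAT IS PROVED (kernel, 0 sorry, 0 def; no `instance`, no `notation`).
* §1 ★★ `reading_of_conj_dominates` — GENERIC AGMON READING: `Good(Φ) ≤ ⟨ωΦ, T(ω⁻¹Φ)⟩_τ` for all `Φ`, `TΦ = Ψ`, `Ψ = 0` off `B`, `ω = 1` on `B` ⟹ `Good(ωΦ) ≤ ‖1_BΦ‖_τ‖Ψ‖_τ`
  (FILE 1's reading for an ARBITRARY functional `Good` in place of `c₀Σ_zM_z|·|²`).
* §2 ★★ `gradEnergy_conj_le` — for the genuine `Ω₀Δ′_a(U₀)Ω₀` with the displayed `hco` and `J_b + J_s ≤ θc₀M` (`0 ≤ θ ≤ 1`): `(1−θ)·Σ_μΣᶠ_x Re τ((D_μΦ)*(D_μΦ)) ≤ ⟨ωΦ, Δ′_a(ω⁻¹Φ)⟩_τ`.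
* §3 ★★★ `gradEnergy_scaleFn_GpZd_le` — THE WEIGHTED GRADIENT ENERGY OF THE SOLUTION: `Σ_μΣᶠ_x|D_μ(ω·G′(U₀)Ψ)(x)|²_τ ≤ ‖Ψ‖²_τ∕((1−θ)²c₀M_B)` (`ω = 1` on `B ⊇ supp Ψ`, `M ≥ M_B > 0`
  on `B`, `0 ≤ θ < 1`).
* §4 `fnorm_covDerivFwd_le_of_scale` (`|D_μΦ(x)|_τ ≤ ω(x)⁻¹|D_μ(ωΦ)(x)|_τ + |η|⁻¹|ω(x+e_μ)∕ω(x) − 1|·|Φ(x+e_μ)|_τ`), `sum_sq_covDerivFwd_le_gradEnergy` (a partial sum of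
  `|D_μF|²` is below the gradient energy), and ★★★ `sq_sum_covDerivFwd_GpZd_le` — THE TAIL GRADIENT BOUND on a finite `A` with `ω ≥ W > 0` on `A`, bond ratios
  `|ω(x+e_μ)∕ω(x) − 1| ≤ r` on `A`, `M ≥ M_A > 0` on `A + e_μ`, `ω ≥ W` on `A + e_μ`:
  `Σ_{x∈A}|D_μ(G′(U₀)Ψ)(x)|²_τ ≤ (2∕W²)·‖Ψ‖²_τ∕((1−θ)²c₀M_B) + 2η⁻²r²·‖Ψ‖²_τ∕(((1−θ)c₀)²M_AM_BW²)`.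

HONEST SCOPE.  Reductions with explicit constants to the DISPLAYED coercivity `hco` and weight data (discharged at cube members by FILES 5–7: flat and near-flat); `L²_τ`
currency; the `ζ`-cutoff ∕ `h`-localisation of print's entry is rendered by the finite set `A` and the weight floor `W`; the Laplacian entry `‖hζΔ_UG′λ‖(Lʲη)²` and the Hölder ∕
sup-norm entries are NOT here.  Count-neutral; N05 ∕ N06 NOT discharged; K1⁹ `stmt-QuantumFields-27364` NOT closed; one finite `𝕋⁴` programme at fixed `ε`, Bałaban as printed; R4
closes only the conditional finite-`𝕋⁴` rung `BalabanLadder.UV` — nothing continuum ∕ ℝ⁴ ∕ OS ∕ mass gap ∕ Clay.  Unit `pub-ymgap-dag-n06-w2` (g5), 2026-08-28.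
-/

noncomputable section

open scoped BigOperators

namespace Literature.MathematicalPhysics.QuantumFieldTheory.Balaban1983to89.B9Eq346AgmonGradientZd

open B7Prop1Explicit (e)
open B7Eq78Linearization (conjR)
open B7Prop2Explicit (unitaryUnits)
open B8Ineq132 (covDerivFwd)
open B8Eq119TwistedAxial (bgT)
open B9Eq321LandauProjectionZd (suppSub formE formE_apply)
open B9Eq324DeltaPrimeAZd (single restrictSite restrictSite_coe deltaPrimeADom GpZd deltaPrimeADom_GpZd)
open B9Eq325QprimeSingleSiteZd (blockMapIter)
open B9Eq342CombesThomasFormZd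
open B9Thm31GpDecayOfCoerciveZd (fnorm_conjR_of_unitary fnorm_sub_le)
open B9Eq346AgmonReadingZd (formE_scaleFn_left formE_scaleFn_indicator_self scaleFn_scaleFn scaleFn_inv_scaleFn sq_sum_le_of_coercive
  sq_sum_le_of_conj_coercive conj_coercive_of_defect)
open B9Eq323ConjugatedLaplacianFormZd (bondRatio covDerivFwd_scale finsum_pair_covDerivFwd_eq_sum)
open B9Thm31GpAgmonDecayZd (formE_conj_deltaPrimeADom_ge_of_masses)
open B9Thm31GreenPrimeGradientL2BoundZd (gradEnergy_le_formE_deltaPrimeADom)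

export B7Prop1Explicit (Site)

variable {d : ℕ} {𝔸 : Type*} [CStarAlgebra 𝔸]

/-! ## §1  The generic Agmon reading for an arbitrary dominated functional -/

section Reading

variable {τ : 𝔸 →ₗ[ℂ] ℂ} {s : Finset (Site d)} {T : suppSub (𝔸 := 𝔸) s →ₗ[ℝ] suppSub (𝔸 := 𝔸) s}

/-- ★★ **THE GENERIC AGMON READING**: if the conjugated form dominates a functional, `Good(Φ) ≤ ⟨ωΦ, T(ω⁻¹Φ)⟩_τ` for all `Φ` (`ω > 0`), then for every solution of `TΦ = Ψ` with `Ψ = 0`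
off `B` and `ω = 1` on `B`: `Good(ωΦ) ≤ ‖1_BΦ‖_τ·‖Ψ‖_τ` (read the hypothesis at `Φ′ = ωΦ`: the right side is `⟨ω²Φ, Ψ⟩ = ⟨1_BΦ, Ψ⟩`).
[cite: Balaban1985BackgroundPropagators, (3.46) p.398, Thm 3.1 p.397; Agmon1982, Thm 1.5 p.19] -/
theorem reading_of_conj_dominates (hτp : ∀ a : 𝔸, a ≠ 0 → 0 < (τ (star a * a)).re) (hτs : ∀ a : 𝔸, τ (star a) = starRingEnd ℂ (τ a))
    {ω : Site d → ℝ} (hω : ∀ z, 0 < ω z) {Good : suppSub (𝔸 := 𝔸) s → ℝ}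
    (hcc : ∀ Φ : suppSub (𝔸 := 𝔸) s, Good Φ ≤ formE τ s (scaleFn s ω Φ) (T (scaleFn s (fun z => (ω z)⁻¹) Φ)))
    {B : Finset (Site d)} (hωB : ∀ z ∈ B, ω z = 1)
    {Φ Ψ : suppSub (𝔸 := 𝔸) s} (hΨB : ∀ z, z ∉ B → (Ψ : Site d → 𝔸) z = 0) (hTΦ : T Φ = Ψ) :
    Good (scaleFn s ω Φ) ≤ Real.sqrt (∑ z ∈ s ∩ B, fnorm τ ((Φ : Site d → 𝔸) z) ^ 2) * Real.sqrt (formE τ s Ψ Ψ) := by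
  classical
  have h := hcc (scaleFn s ω Φ)
  rw [scaleFn_inv_scaleFn (fun z => (hω z).ne') Φ, hTΦ, scaleFn_scaleFn, formE_scaleFn_left] at h
  set χ : Site d → ℝ := fun z => if z ∈ B then (1 : ℝ) else 0 with hχ
  have hsum : ∑ z ∈ s, ω z * ω z * (τ (star ((Φ : Site d → 𝔸) z) * (Ψ : Site d → 𝔸) z)).re =
      formE τ s (scaleFn s χ Φ) Ψ := by
    rw [formE_scaleFn_left]
    refine Finset.sum_congr rfl fun z _ => ?_
    by_cases hz : z ∈ B
    · simp only [hχ, hz, if_true, hωB z hz, one_mul]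
    · simp only [hχ, hz, if_false, hΨB z hz, mul_zero, map_zero, Complex.zero_re]
  rw [hsum] at h
  have hcs := (le_abs_self _).trans (abs_formE_le hτp hτs (scaleFn s χ Φ) Ψ)
  rw [formE_scaleFn_indicator_self hτp B Φ] at hcs
  exact h.trans hcs

end Reading

/-! ## §2  The conjugated form of `Ω₀Δ′_a(U₀)Ω₀` dominates `(1−θ)·` the gradient energy -/

section GradEnergy

variable {L : ℕ} {U₀ : Site d → Fin d → 𝔸ˣ} {η : ℝ} (τ : 𝔸 →ₗ[ℂ] ℂ) {s : Finset (Site d)} [FiniteDimensional ℝ 𝔸]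
  (hτp : ∀ a : 𝔸, a ≠ 0 → 0 < (τ (star a * a)).re) {m : ℕ} {a : ℕ → ℝ} {Λ : ℕ → Finset (Site d)}

/-- ★★ **THE CONJUGATED FORM DOMINATES THE GRADIENT ENERGY**: under the displayed level-weighted coercivity `c₀ΣM|Φ|² ≤ ⟨Φ, Δ′_aΦ⟩` and the mass domination
`J_b + J_s ≤ θc₀M` (`0 ≤ θ`) of the weight `ω`, for every `Φ ∈ L²(Ω₀, ·)`: `(1−θ)·Σ_μΣᶠ_x Re τ((D_μΦ)(x)*(D_μΦ)(x)) ≤ ⟨ωΦ, Δ′_a(ω⁻¹Φ)⟩_τ`.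
[cite: Balaban1985BackgroundPropagators, (3.23)–(3.24) p.394, (3.46) p.398; Agmon1982, Thm 1.5 p.19] -/
theorem gradEnergy_conj_le [NeZero L] (hτt : ∀ a b : 𝔸, τ (a * b) = τ (b * a)) (hτs : ∀ a : 𝔸, τ (star a) = starRingEnd ℂ (τ a))
    (hU : ∀ (x : Site d) (κ : Fin d), U₀ x κ ∈ unitaryUnits 𝔸) (hT : ∀ j', j' < m → ∀ z y : Site d, bgT L U₀ j' z y ∈ unitaryUnits 𝔸)
    (ha : ∀ j, 0 ≤ a j) {c₀ θ : ℝ} (hθ0 : 0 ≤ θ) (hθ1 : θ ≤ 1) {M : Site d → ℝ}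
    (hco : ∀ Φ : suppSub (𝔸 := 𝔸) s, c₀ * ∑ z ∈ s, M z * fnorm τ ((Φ : Site d → 𝔸) z) ^ 2 ≤ formE τ s Φ (deltaPrimeADom L U₀ η τ hτp m a Λ s Φ))
    {ω : Site d → ℝ} (hω : ∀ z, 0 < ω z) {wref : ℕ → Site d → ℝ} (hwref : ∀ j y, 0 < wref j y) {ε ε' : ℕ → ℝ} (hε : ∀ j, 0 ≤ ε j) (hε' : ∀ j, 0 ≤ ε' j)
    (hosc : ∀ j ∈ Finset.range (m + 1), ∀ y ∈ Λ j, ∀ x ∈ s, blockMapIter L j x = y → |ω x / wref j y - 1| ≤ ε j ∧ |wref j y / ω x - 1| ≤ ε' j)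
    (hJ : ∀ z ∈ s, ((η⁻¹) ^ 2 * ∑ μ : Fin d, (5 / 2 * bondRatio ω (z - e μ) μ + 1 / 2 * bondRatio ω z μ)) +
      ∑ j ∈ Finset.range (m + 1),
        (if blockMapIter L j z ∈ Λ j then a j * (ε j + ε' j + ε j * ε' j) * (((L : ℝ) ^ d)⁻¹) ^ j else 0) ≤ θ * c₀ * M z)
    (Φ : suppSub (𝔸 := 𝔸) s) :
    (1 - θ) * ∑ μ : Fin d, ∑ᶠ x, (τ (star (covDerivFwd η U₀ μ (Φ : Site d → 𝔸) x) * covDerivFwd η U₀ μ (Φ : Site d → 𝔸) x)).re ≤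
      formE τ s (scaleFn s ω Φ) (deltaPrimeADom L U₀ η τ hτp m a Λ s (scaleFn s (fun z => (ω z)⁻¹) Φ)) := by
  have hdef := formE_conj_deltaPrimeADom_ge_of_masses τ hτp hτt hτs hU hT ha hω hwref hε hε' hosc hJ Φ (η := η)
  have h1 := hco Φ
  have hgrad := gradEnergy_le_formE_deltaPrimeADom τ hτp hτt hτs m ha Λ s hU Φ (L := L) (η := η)
  have hA := mul_le_mul_of_nonneg_left h1 hθ0
  have hB := mul_le_mul_of_nonneg_left hgrad (sub_nonneg.2 hθ1)
  linarith

end GradEnergy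

/-! ## §3  ★★★ The weighted gradient energy of the solution -/

section Weighted

variable (L : ℕ) (U₀ : Site d → Fin d → 𝔸ˣ) (η : ℝ) (τ : 𝔸 →ₗ[ℂ] ℂ) [FiniteDimensional ℝ 𝔸]
  (hτp : ∀ a : 𝔸, a ≠ 0 → 0 < (τ (star a * a)).re) (m : ℕ) (a : ℕ → ℝ) (Λ : ℕ → Finset (Site d)) (s : Finset (Site d))

/-- ★★★ **THE WEIGHTED GRADIENT ENERGY OF `G′(U₀)Ψ` — (3.46)'s GRADIENT ENTRY, SHAPE.**  `L ≥ 1`; unitary `U₀` with unitary averaged transporters; `a ≥ 0`; `0 < d`, `η ≠ 0`;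
tracial Hermitian faithful `τ`; displayed `hco` (`c₀ > 0`, `M ≥ 0`); a weight `ω > 0` with block data and `J_b + J_s ≤ θc₀M` (`0 ≤ θ < 1`); `Ψ` vanishing off `B`, `ω = 1` on `B`,
`M ≥ M_B > 0` on `B`.  THEN `Σ_μ Σᶠ_x |D^η_{U₀,μ}(ω·G′(U₀)Ψ)(x)|²_τ ≤ ‖Ψ‖²_τ ∕ ((1−θ)²·c₀·M_B)` — ONE inverse mass (print's `(Lʲ′η)²`), the weight inside.
[cite: Balaban1985BackgroundPropagators, (3.46) p.398, Thm 3.1 p.397, (3.24) p.394; Agmon1982, Thm 1.5 p.19] -/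
theorem gradEnergy_scaleFn_GpZd_le [NeZero L] (hd : 0 < d) (hη : η ≠ 0) (hτt : ∀ a b : 𝔸, τ (a * b) = τ (b * a))
    (hτs : ∀ a : 𝔸, τ (star a) = starRingEnd ℂ (τ a)) (hU : ∀ (x : Site d) (κ : Fin d), U₀ x κ ∈ unitaryUnits 𝔸)
    (hT : ∀ j', j' < m → ∀ z y : Site d, bgT L U₀ j' z y ∈ unitaryUnits 𝔸) (ha : ∀ j, 0 ≤ a j)
    {c₀ θ : ℝ} (hc₀ : 0 < c₀) (hθ0 : 0 ≤ θ) (hθ1 : θ < 1) {M : Site d → ℝ} (hM0 : ∀ z ∈ s, 0 ≤ M z)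
    (hco : ∀ Φ : suppSub (𝔸 := 𝔸) s, c₀ * ∑ z ∈ s, M z * fnorm τ ((Φ : Site d → 𝔸) z) ^ 2 ≤ formE τ s Φ (deltaPrimeADom L U₀ η τ hτp m a Λ s Φ))
    {ω : Site d → ℝ} (hω : ∀ z, 0 < ω z) {wref : ℕ → Site d → ℝ} (hwref : ∀ j y, 0 < wref j y) {ε ε' : ℕ → ℝ} (hε : ∀ j, 0 ≤ ε j) (hε' : ∀ j, 0 ≤ ε' j)
    (hosc : ∀ j ∈ Finset.range (m + 1), ∀ y ∈ Λ j, ∀ x ∈ s, blockMapIter L j x = y → |ω x / wref j y - 1| ≤ ε j ∧ |wref j y / ω x - 1| ≤ ε' j)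
    (hJ : ∀ z ∈ s, ((η⁻¹) ^ 2 * ∑ μ : Fin d, (5 / 2 * bondRatio ω (z - e μ) μ + 1 / 2 * bondRatio ω z μ)) +
      ∑ j ∈ Finset.range (m + 1),
        (if blockMapIter L j z ∈ Λ j then a j * (ε j + ε' j + ε j * ε' j) * (((L : ℝ) ^ d)⁻¹) ^ j else 0) ≤ θ * c₀ * M z)
    {mB : ℝ} (hmB : 0 < mB) {B : Finset (Site d)} (hmB' : ∀ z ∈ B, mB ≤ M z) (hωB : ∀ z ∈ B, ω z = 1)
    {Ψ : suppSub (𝔸 := 𝔸) s} (hΨB : ∀ z, z ∉ B → (Ψ : Site d → 𝔸) z = 0) :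
    ∑ μ : Fin d, ∑ᶠ x, fnorm τ (covDerivFwd η U₀ μ
        (scaleFn s ω (GpZd L U₀ η τ hτp m a Λ s hd hη hτt hτs hU ha Ψ) : Site d → 𝔸) x) ^ 2 ≤
      formE τ s Ψ Ψ / ((1 - θ) ^ 2 * c₀ * mB) := by
  set T := deltaPrimeADom L U₀ η τ hτp m a Λ s with hT'
  set Φ := GpZd L U₀ η τ hτp m a Λ s hd hη hτt hτs hU ha Ψ with hΦ
  have hTΦ : T Φ = Ψ := deltaPrimeADom_GpZd hd hη hτt hτs hU ha Ψ
  have hθ' : 0 < 1 - θ := by linarith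
  -- the Good functional: `(1−θ)·gradEnergy`
  have hgood := reading_of_conj_dominates (T := T) hτp hτs hω
    (Good := fun Φ' : suppSub (𝔸 := 𝔸) s => (1 - θ) * ∑ μ : Fin d, ∑ᶠ x,
      (τ (star (covDerivFwd η U₀ μ (Φ' : Site d → 𝔸) x) * covDerivFwd η U₀ μ (Φ' : Site d → 𝔸) x)).re)
    (fun Φ' => gradEnergy_conj_le τ hτp hτt hτs hU hT ha hθ0 hθ1.le hco hω hwref hε hε' hosc hJ Φ') hωB hΨB hTΦ
  -- first reading: `‖1_BΦ‖ ≤ ‖Ψ‖∕(c₀ m_B)` (plain coercivity with `c₀`)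
  have hfirst := sq_sum_le_of_coercive (T := T) hτp hτs hc₀ hmB hM0 hco hmB' hΨB hTΦ
  set SB := ∑ z ∈ s ∩ B, fnorm τ ((Φ : Site d → 𝔸) z) ^ 2 with hSB
  set N := formE τ s Ψ Ψ with hN
  have hSB0 : 0 ≤ SB := Finset.sum_nonneg fun z _ => sq_nonneg _
  have hN0 : 0 ≤ N := formE_self_nonneg' hτp Ψ
  have hcm : 0 < c₀ * mB := mul_pos hc₀ hmB
  have hXB : Real.sqrt SB ≤ Real.sqrt N / (c₀ * mB) := by
    rw [le_div_iff₀ hcm, ← Real.sqrt_sq hcm.le, ← Real.sqrt_mul hSB0]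
    exact Real.sqrt_le_sqrt ((le_div_iff₀ (pow_pos hcm 2)).1 hfirst)
  -- combine
  have hG : (1 - θ) * ∑ μ : Fin d, ∑ᶠ x, (τ (star (covDerivFwd η U₀ μ (scaleFn s ω Φ : Site d → 𝔸) x) *
      covDerivFwd η U₀ μ (scaleFn s ω Φ : Site d → 𝔸) x)).re ≤ Real.sqrt N / (c₀ * mB) * Real.sqrt N :=
    hgood.trans (mul_le_mul_of_nonneg_right hXB (Real.sqrt_nonneg _))
  rw [div_mul_eq_mul_div, ← sq, Real.sq_sqrt hN0] at hG
  have hE : ∑ μ : Fin d, ∑ᶠ x, fnorm τ (covDerivFwd η U₀ μ (scaleFn s ω Φ : Site d → 𝔸) x) ^ 2 =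
      ∑ μ : Fin d, ∑ᶠ x, (τ (star (covDerivFwd η U₀ μ (scaleFn s ω Φ : Site d → 𝔸) x) * covDerivFwd η U₀ μ (scaleFn s ω Φ : Site d → 𝔸) x)).re :=
    Finset.sum_congr rfl fun μ _ => finsum_congr fun x => fnorm_sq hτp _
  rw [hE, le_div_iff₀ (by positivity)]
  calc (∑ μ : Fin d, ∑ᶠ x, (τ (star (covDerivFwd η U₀ μ (scaleFn s ω Φ : Site d → 𝔸) x) *
        covDerivFwd η U₀ μ (scaleFn s ω Φ : Site d → 𝔸) x)).re) * ((1 - θ) ^ 2 * c₀ * mB)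
      = (1 - θ) * (c₀ * mB) * ((1 - θ) * ∑ μ : Fin d, ∑ᶠ x, (τ (star (covDerivFwd η U₀ μ (scaleFn s ω Φ : Site d → 𝔸) x) *
          covDerivFwd η U₀ μ (scaleFn s ω Φ : Site d → 𝔸) x)).re) := by ring
    _ ≤ (1 - θ) * (c₀ * mB) * (N / (c₀ * mB)) := mul_le_mul_of_nonneg_left hG (by positivity)
    _ = (1 - θ) * N := by field_simp
    _ ≤ N := by nlinarith

end Weighted

/-! ## §4  Unweighting on a tail set -/

section Tail

variable {η : ℝ} {U₀ : Site d → Fin d → 𝔸ˣ} (τ : 𝔸 →ₗ[ℂ] ℂ)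

/-- **UNWEIGHTING ONE BOND**: `|(D_μΦ)(x)|_τ ≤ ω(x)⁻¹·|(D_μ(ωΦ))(x)|_τ + |η|⁻¹·|ω(x+e_μ)∕ω(x) − 1|·|Φ(x+e_μ)|_τ` (`ω > 0`, unitary `U₀`, tracial `τ`) — from `covDerivFwd_scale`.
[cite: Balaban1985RegularSpaces, (1.1) p.76; Balaban1985BackgroundPropagators, (3.46) p.398 (the cutoff `ζ`)] -/
theorem fnorm_covDerivFwd_le_of_scale (hτp : ∀ a : 𝔸, a ≠ 0 → 0 < (τ (star a * a)).re) (hτt : ∀ a b : 𝔸, τ (a * b) = τ (b * a))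
    (hτs : ∀ a : 𝔸, τ (star a) = starRingEnd ℂ (τ a)) (hU : ∀ (x : Site d) (κ : Fin d), U₀ x κ ∈ unitaryUnits 𝔸)
    {ω : Site d → ℝ} (hω : ∀ z, 0 < ω z) (F : Site d → 𝔸) (μ : Fin d) (x : Site d) :
    fnorm τ (covDerivFwd η U₀ μ F x) ≤ (ω x)⁻¹ * fnorm τ (covDerivFwd η U₀ μ (fun z => ω z • F z) x) +
      |η|⁻¹ * |ω (x + e μ) / ω x - 1| * fnorm τ (F (x + e μ)) := by
  have hsc := covDerivFwd_scale η U₀ μ ω F x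
  have hωx := hω x
  -- `ω(x)·D F(x) = D(ωF)(x) − η⁻¹(ω(x+e) − ω(x))·C`
  have hid : covDerivFwd η U₀ μ F x = (ω x)⁻¹ • (covDerivFwd η U₀ μ (fun z => ω z • F z) x -
      (η⁻¹ * (ω (x + e μ) - ω x)) • conjR (U₀ x μ) (F (x + e μ))) := by
    rw [hsc, add_sub_cancel_right, smul_smul, inv_mul_cancel₀ hωx.ne', one_smul]
  rw [hid, fnorm_smul, abs_of_pos (inv_pos.2 hωx)]
  have h1 := fnorm_sub_le τ hτp hτs (covDerivFwd η U₀ μ (fun z => ω z • F z) x) ((η⁻¹ * (ω (x + e μ) - ω x)) • conjR (U₀ x μ) (F (x + e μ)))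
  rw [fnorm_smul, fnorm_conjR_of_unitary τ hτt (hU x μ)] at h1
  have hratio : (ω x)⁻¹ * |η⁻¹ * (ω (x + e μ) - ω x)| = |η|⁻¹ * |ω (x + e μ) / ω x - 1| := by
    rw [abs_mul, abs_inv, show ω (x + e μ) / ω x - 1 = (ω x)⁻¹ * (ω (x + e μ) - ω x) by field_simp, abs_mul, abs_of_pos (inv_pos.2 hωx)]
    ring
  calc (ω x)⁻¹ * fnorm τ (covDerivFwd η U₀ μ (fun z => ω z • F z) x - (η⁻¹ * (ω (x + e μ) - ω x)) • conjR (U₀ x μ) (F (x + e μ)))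
      ≤ (ω x)⁻¹ * (fnorm τ (covDerivFwd η U₀ μ (fun z => ω z • F z) x) + |η⁻¹ * (ω (x + e μ) - ω x)| * fnorm τ (F (x + e μ))) :=
        mul_le_mul_of_nonneg_left h1 (inv_pos.2 hωx).le
    _ = (ω x)⁻¹ * fnorm τ (covDerivFwd η U₀ μ (fun z => ω z • F z) x) + |η|⁻¹ * |ω (x + e μ) / ω x - 1| * fnorm τ (F (x + e μ)) := by
        rw [mul_add, ← mul_assoc, hratio]

/-- **A PARTIAL SUM OF `|D_μF|²` IS BELOW THE GRADIENT ENERGY** (`F` supported in `Ω₀`, faithful `τ`). [cite: Balaban1985BackgroundPropagators, (3.23) p.394 (bookkeeping)] -/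
theorem sum_sq_covDerivFwd_le_gradEnergy (hτp : ∀ a : 𝔸, a ≠ 0 → 0 < (τ (star a * a)).re) {s : Finset (Site d)} (A : Finset (Site d)) (μ : Fin d)
    {F : Site d → 𝔸} (hF : ∀ z, z ∉ s → F z = 0) :
    ∑ x ∈ A, fnorm τ (covDerivFwd η U₀ μ F x) ^ 2 ≤ ∑ ν : Fin d, ∑ᶠ x, fnorm τ (covDerivFwd η U₀ ν F x) ^ 2 := by
  classical
  have hconv : ∀ ν : Fin d, ∑ᶠ x, fnorm τ (covDerivFwd η U₀ ν F x) ^ 2 = ∑ x ∈ s ∪ s.image (fun z => z - e ν), fnorm τ (covDerivFwd η U₀ ν F x) ^ 2 := by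
    intro ν
    have h := finsum_pair_covDerivFwd_eq_sum τ ν (fun x => covDerivFwd η U₀ ν F x) hF (η := η) (U₀ := U₀)
    have h' : ∀ x, (τ (star (covDerivFwd η U₀ ν F x) * covDerivFwd η U₀ ν F x)).re = fnorm τ (covDerivFwd η U₀ ν F x) ^ 2 := fun x => (fnorm_sq hτp _).symm
    simpa only [h'] using h
  have hμ : ∑ x ∈ A, fnorm τ (covDerivFwd η U₀ μ F x) ^ 2 ≤ ∑ᶠ x, fnorm τ (covDerivFwd η U₀ μ F x) ^ 2 := by
    rw [hconv μ]
    -- terms outside `s ∪ (s − e_μ)` vanish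
    have hvan : ∀ x, x ∉ s ∪ s.image (fun z => z - e μ) → fnorm τ (covDerivFwd η U₀ μ F x) ^ 2 = 0 := by
      intro x hx
      rw [B9Eq323ConjugatedLaplacianFormZd.covDerivFwd_eq_zero_off μ hF hx, fnorm_zero]; ring
    calc ∑ x ∈ A, fnorm τ (covDerivFwd η U₀ μ F x) ^ 2
        = ∑ x ∈ A ∩ (s ∪ s.image (fun z => z - e μ)), fnorm τ (covDerivFwd η U₀ μ F x) ^ 2 := by
          rw [← Finset.sum_filter_add_sum_filter_not A (fun x => x ∈ s ∪ s.image (fun z => z - e μ))]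
          rw [Finset.sum_eq_zero (s := A.filter (fun x => x ∉ s ∪ s.image (fun z => z - e μ)))
            (fun x hx => hvan x (Finset.mem_filter.1 hx).2), add_zero, Finset.filter_mem_eq_inter]
      _ ≤ ∑ x ∈ s ∪ s.image (fun z => z - e μ), fnorm τ (covDerivFwd η U₀ μ F x) ^ 2 :=
          Finset.sum_le_sum_of_subset_of_nonneg Finset.inter_subset_right fun _ _ _ => sq_nonneg _
  exact hμ.trans (Finset.single_le_sum (f := fun ν => ∑ᶠ x, fnorm τ (covDerivFwd η U₀ ν F x) ^ 2)
    (fun ν _ => finsum_nonneg fun x => sq_nonneg _) (Finset.mem_univ μ))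

end Tail

section TailBound

variable (L : ℕ) (U₀ : Site d → Fin d → 𝔸ˣ) (η : ℝ) (τ : 𝔸 →ₗ[ℂ] ℂ) [FiniteDimensional ℝ 𝔸]
  (hτp : ∀ a : 𝔸, a ≠ 0 → 0 < (τ (star a * a)).re) (m : ℕ) (a : ℕ → ℝ) (Λ : ℕ → Finset (Site d)) (s : Finset (Site d))

/-- ★★★ **THE TAIL GRADIENT BOUND — (3.46)'s GRADIENT ENTRY ON A SET.**  Data as in `gradEnergy_scaleFn_GpZd_le`, plus the plain∕conjugated readings for the value term:
on a finite `A` with `ω ≥ W > 0` on `A` and on `A + e_μ`, bond ratios `|ω(x+e_μ)∕ω(x) − 1| ≤ r` (`r ≥ 0`) for `x ∈ A`, and `M ≥ M_A > 0` on `A + e_μ`: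
`Σ_{x∈A}|D_μ(G′(U₀)Ψ)(x)|²_τ ≤ (2∕W²)·‖Ψ‖²_τ∕((1−θ)²c₀M_B) + 2η⁻²r²·‖Ψ‖²_τ∕(((1−θ)c₀)²M_AM_BW²)`.
[cite: Balaban1985BackgroundPropagators, (3.46) p.398, Thm 3.1 p.397; Agmon1982, Thm 1.5 p.19] -/
theorem sq_sum_covDerivFwd_GpZd_le [NeZero L] (hd : 0 < d) (hη : η ≠ 0) (hτt : ∀ a b : 𝔸, τ (a * b) = τ (b * a))
    (hτs : ∀ a : 𝔸, τ (star a) = starRingEnd ℂ (τ a)) (hU : ∀ (x : Site d) (κ : Fin d), U₀ x κ ∈ unitaryUnits 𝔸)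
    (hT : ∀ j', j' < m → ∀ z y : Site d, bgT L U₀ j' z y ∈ unitaryUnits 𝔸) (ha : ∀ j, 0 ≤ a j)
    {c₀ θ : ℝ} (hc₀ : 0 < c₀) (hθ0 : 0 ≤ θ) (hθ1 : θ < 1) {M : Site d → ℝ} (hM0 : ∀ z ∈ s, 0 ≤ M z)
    (hco : ∀ Φ : suppSub (𝔸 := 𝔸) s, c₀ * ∑ z ∈ s, M z * fnorm τ ((Φ : Site d → 𝔸) z) ^ 2 ≤ formE τ s Φ (deltaPrimeADom L U₀ η τ hτp m a Λ s Φ))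
    {ω : Site d → ℝ} (hω : ∀ z, 0 < ω z) {wref : ℕ → Site d → ℝ} (hwref : ∀ j y, 0 < wref j y) {ε ε' : ℕ → ℝ} (hε : ∀ j, 0 ≤ ε j) (hε' : ∀ j, 0 ≤ ε' j)
    (hosc : ∀ j ∈ Finset.range (m + 1), ∀ y ∈ Λ j, ∀ x ∈ s, blockMapIter L j x = y → |ω x / wref j y - 1| ≤ ε j ∧ |wref j y / ω x - 1| ≤ ε' j)
    (hJ : ∀ z ∈ s, ((η⁻¹) ^ 2 * ∑ μ : Fin d, (5 / 2 * bondRatio ω (z - e μ) μ + 1 / 2 * bondRatio ω z μ)) +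
      ∑ j ∈ Finset.range (m + 1),
        (if blockMapIter L j z ∈ Λ j then a j * (ε j + ε' j + ε j * ε' j) * (((L : ℝ) ^ d)⁻¹) ^ j else 0) ≤ θ * c₀ * M z)
    {mA mB W r : ℝ} (hmA : 0 < mA) (hmB : 0 < mB) (hW : 0 < W) (hr : 0 ≤ r) {A B : Finset (Site d)} (μ : Fin d)
    (hmA' : ∀ z ∈ A.image (fun x => x + e μ), mA ≤ M z) (hmB' : ∀ z ∈ B, mB ≤ M z)
    (hWA : ∀ z ∈ A, W ≤ ω z) (hWA' : ∀ z ∈ A.image (fun x => x + e μ), W ≤ ω z) (hωB : ∀ z ∈ B, ω z = 1)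
    (hratio : ∀ x ∈ A, |ω (x + e μ) / ω x - 1| ≤ r)
    {Ψ : suppSub (𝔸 := 𝔸) s} (hΨB : ∀ z, z ∉ B → (Ψ : Site d → 𝔸) z = 0) :
    ∑ x ∈ A, fnorm τ (covDerivFwd η U₀ μ (GpZd L U₀ η τ hτp m a Λ s hd hη hτt hτs hU ha Ψ : Site d → 𝔸) x) ^ 2 ≤
      2 * (1 / W ^ 2) * (formE τ s Ψ Ψ / ((1 - θ) ^ 2 * c₀ * mB)) +
        2 * ((η⁻¹) ^ 2 * r ^ 2 * (formE τ s Ψ Ψ / (((1 - θ) * c₀) ^ 2 * mA * mB * W ^ 2))) := by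
  classical
  set Φ := GpZd L U₀ η τ hτp m a Λ s hd hη hτt hτs hU ha Ψ with hΦ
  set F : Site d → 𝔸 := (Φ : Site d → 𝔸) with hF
  have hFs : ∀ z, z ∉ s → F z = 0 := fun z hz => Φ.2 z hz
  -- the weighted gradient energy (§3) and the value reading on `A + e_μ` (FILE 3's second reading)
  have hgrad := gradEnergy_scaleFn_GpZd_le L U₀ η τ hτp m a Λ s hd hη hτt hτs hU hT ha hc₀ hθ0 hθ1 hM0 hco hω hwref hε hε' hosc hJ hmB hmB' hωB hΨB
  have hval := B9Thm31GpAgmonDecayZd.sq_sum_GpZd_le_of_levelCoercive L U₀ η τ hτp m a Λ s hd hη hτt hτs hU hT ha hc₀ hθ0 hθ1 hM0 hco hω hwref hε hε'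
    hosc hJ hmA hmB hW hmA' hmB' hWA' hωB hΨB
  set N := formE τ s Ψ Ψ with hN
  have hN0 : 0 ≤ N := formE_self_nonneg' hτp Ψ
  set Gω : ℝ := ∑ ν : Fin d, ∑ᶠ x, fnorm τ (covDerivFwd η U₀ ν (scaleFn s ω Φ : Site d → 𝔸) x) ^ 2 with hGω
  set V : ℝ := ∑ z ∈ s ∩ A.image (fun x => x + e μ), fnorm τ (F z) ^ 2 with hV
  -- pointwise unweighting, squared: `|DΦ(x)|² ≤ 2W⁻²|D(ωΦ)(x)|² + 2η⁻²r²|Φ(x+e)|²`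
  have hωF : (scaleFn s ω Φ : Site d → 𝔸) = fun z => ω z • F z := rfl
  have hpt : ∀ x ∈ A, fnorm τ (covDerivFwd η U₀ μ F x) ^ 2 ≤
      2 * (W⁻¹) ^ 2 * fnorm τ (covDerivFwd η U₀ μ (scaleFn s ω Φ : Site d → 𝔸) x) ^ 2 + 2 * ((|η|⁻¹ * r) ^ 2 * fnorm τ (F (x + e μ)) ^ 2) := by
    intro x hx
    have h := fnorm_covDerivFwd_le_of_scale τ hτp hτt hτs hU hω F μ x (η := η)
    rw [← hωF] at h
    have hωx : W ≤ ω x := hWA x hx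
    have hωx0 : 0 < ω x := hω x
    have h1 : (ω x)⁻¹ * fnorm τ (covDerivFwd η U₀ μ (scaleFn s ω Φ : Site d → 𝔸) x) ≤ W⁻¹ * fnorm τ (covDerivFwd η U₀ μ (scaleFn s ω Φ : Site d → 𝔸) x) :=
      mul_le_mul_of_nonneg_right ((inv_le_inv₀ hωx0 hW).2 hωx) (fnorm_nonneg τ _)
    have h2 : |η|⁻¹ * |ω (x + e μ) / ω x - 1| * fnorm τ (F (x + e μ)) ≤ |η|⁻¹ * r * fnorm τ (F (x + e μ)) :=
      mul_le_mul_of_nonneg_right (mul_le_mul_of_nonneg_left (hratio x hx) (inv_nonneg.2 (abs_nonneg η))) (fnorm_nonneg τ _)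
    have h3 := h.trans (add_le_add h1 h2)
    have ha0 := fnorm_nonneg τ (covDerivFwd η U₀ μ F x)
    have hb0 : 0 ≤ W⁻¹ * fnorm τ (covDerivFwd η U₀ μ (scaleFn s ω Φ : Site d → 𝔸) x) := mul_nonneg (inv_nonneg.2 hW.le) (fnorm_nonneg τ _)
    have hc0 : 0 ≤ |η|⁻¹ * r * fnorm τ (F (x + e μ)) := mul_nonneg (mul_nonneg (inv_nonneg.2 (abs_nonneg η)) hr) (fnorm_nonneg τ _)
    nlinarith [sq_nonneg (W⁻¹ * fnorm τ (covDerivFwd η U₀ μ (scaleFn s ω Φ : Site d → 𝔸) x) - |η|⁻¹ * r * fnorm τ (F (x + e μ)))]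
  -- sum over `A`
  have hsum : ∑ x ∈ A, fnorm τ (covDerivFwd η U₀ μ F x) ^ 2 ≤ 2 * (W⁻¹) ^ 2 * Gω + 2 * ((|η|⁻¹ * r) ^ 2 * V) := by
    calc ∑ x ∈ A, fnorm τ (covDerivFwd η U₀ μ F x) ^ 2
        ≤ ∑ x ∈ A, (2 * (W⁻¹) ^ 2 * fnorm τ (covDerivFwd η U₀ μ (scaleFn s ω Φ : Site d → 𝔸) x) ^ 2 +
            2 * ((|η|⁻¹ * r) ^ 2 * fnorm τ (F (x + e μ)) ^ 2)) := Finset.sum_le_sum hpt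
      _ = 2 * (W⁻¹) ^ 2 * ∑ x ∈ A, fnorm τ (covDerivFwd η U₀ μ (scaleFn s ω Φ : Site d → 𝔸) x) ^ 2 +
            2 * ((|η|⁻¹ * r) ^ 2 * ∑ x ∈ A, fnorm τ (F (x + e μ)) ^ 2) := by
          rw [Finset.sum_add_distrib, ← Finset.mul_sum, ← Finset.mul_sum, ← Finset.mul_sum]
      _ ≤ 2 * (W⁻¹) ^ 2 * Gω + 2 * ((|η|⁻¹ * r) ^ 2 * V) := by
          have hG' : ∑ x ∈ A, fnorm τ (covDerivFwd η U₀ μ (scaleFn s ω Φ : Site d → 𝔸) x) ^ 2 ≤ Gω :=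
            sum_sq_covDerivFwd_le_gradEnergy τ hτp A μ (fun z hz => (scaleFn s ω Φ).2 z hz)
          have hV' : ∑ x ∈ A, fnorm τ (F (x + e μ)) ^ 2 ≤ V := by
            rw [hV, ← Finset.sum_image (f := fun z => fnorm τ (F z) ^ 2) (fun x _ y _ h => add_right_cancel h)]
            -- shifted sites off `s` contribute zero
            rw [← Finset.sum_filter_add_sum_filter_not (A.image (fun x => x + e μ)) (fun z => z ∈ s)]
            rw [Finset.sum_eq_zero (s := (A.image (fun x => x + e μ)).filter (fun z => z ∉ s))
              (fun z hz => by rw [hFs z (Finset.mem_filter.1 hz).2, fnorm_zero]; ring), add_zero, Finset.filter_mem_eq_inter, Finset.inter_comm]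
          gcongr
  -- insert the two readings
  have hWinv : (W⁻¹) ^ 2 = 1 / W ^ 2 := by rw [inv_pow, one_div]
  have hηabs : (|η|⁻¹ * r) ^ 2 = (η⁻¹) ^ 2 * r ^ 2 := by rw [mul_pow, inv_pow, sq_abs, inv_pow]
  rw [hWinv, hηabs] at hsum
  have hV2 : V ≤ N / (((1 - θ) * c₀) ^ 2 * mA * mB * W ^ 2) := hval
  calc ∑ x ∈ A, fnorm τ (covDerivFwd η U₀ μ F x) ^ 2 ≤ 2 * (1 / W ^ 2) * Gω + 2 * ((η⁻¹) ^ 2 * r ^ 2 * V) := hsum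
    _ ≤ 2 * (1 / W ^ 2) * (N / ((1 - θ) ^ 2 * c₀ * mB)) + 2 * ((η⁻¹) ^ 2 * r ^ 2 * (N / (((1 - θ) * c₀) ^ 2 * mA * mB * W ^ 2))) := by
        gcongr

end TailBound

end Literature.MathematicalPhysics.QuantumFieldTheory.Balaban1983to89.B9Eq346AgmonGradientZd

end
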